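import Literature.Probability.Percolation.SlabRSWGluingSegExtB
import Literature.Probability.Percolation.SlabRSWGluingNearOfCross
import Literature.Probability.Percolation.SlabRSWGluingCrossings
import Literature.Probability.Percolation.SlabRSWGluingOrient
import HarnessLib

/-!
# Newman–Tassion–Wu 2017, Prop. 3.9 (3.29) in the high-probability regime: the two-domain planar
# crossing for the segment-target geometry and the `Γ`-free `ε-δ` gluing lemma

Topic: `Literature/Probability/Percolation`. Puts together `glue_highProb_segExt` (Thm 3.7,
high-probability regime, `SegExtSetup`: `S = [a,b]×[c,d] ⊆ R = [a,b]×[c,d']`, `B = {b}×[y₁,y₂]`),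
`GlueData.real_evNear_ge_of_cross₂` and a planar fact: every planar walk in `S` from the bottom row
to a right-side cell at height `≥ t` meets every planar walk in `R` from the row `y = d'` to a
right-side cell at height `≤ t < d` (the latter's final portion after its last visit to `{y ≥ d}`
runs in `S` from the top row of `S`; then p2's `planarCrossing_sides_bottom` after the symmetry
`(x, y) ↦ (c + d - y, a + b - x)`). Result: **`glue0_highProb_segExt`** — for `A` on the bottom row
of `S`, `C` on the top row of `R`, `D'` on the right side below `B`: `P[A ⟷^S B] ≥ 1-δ` and
`P[C ⟷^R D'] ≥ 1-δ` imply `P[C ⟷^R A] ≥ 1-η`, `δ` uniform in the geometry. This is the gluing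
(3.29) of the proof of Prop. 3.9 (1) (after a rotation: `C ⟷^R A` is the long crossing of `R`).

* `planarCrossing_bottom_top_rightSegs`, `cross₂_of_segExtTop`, **`glue0_highProb_segExt`**.

## Sources

* C. M. Newman, V. Tassion, W. Wu, *Critical percolation and the minimal spanning tree in slabs*,
  Comm. Pure Appl. Math. 70 (2017), arXiv:1512.09107: Proposition 3.9 (proof, (3.29)),
  Theorem 3.6/3.7 (high-probability regime) [NewmanTassionWu2017].
-/

noncomputable section

namespace Literature.Probability.Percolation

open MeasureTheory LatticeModels SimpleGraph

namespace NTW17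

variable {k : ℕ}

/-! ## The planar crossings -/

/-- The symmetry `(x, y) ↦ (c + d - y, a + b - x)` (a reflection in both axes followed by the
diagonal swap). [cite: NewmanTassionWu2017, §3.3 ("by symmetry")] -/
def rotReflect (s t : ℤ) : ℤ × ℤ ≃ ℤ × ℤ :=
  ((planarReflect s).trans (planarFlip t)).trans planarSwap

/-- `rotReflect s t` acts as `(x, y) ↦ (t - y, s - x)`. [cite: NewmanTassionWu2017, §3.3 ("by symmetry")] -/
@[simp] theorem rotReflect_apply (s t : ℤ) (z : ℤ × ℤ) : rotReflect s t z = (t - z.2, s - z.1) := rfl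

/-- `rotReflect` preserves planar adjacency. [cite: NewmanTassionWu2017, §3.3 ("by symmetry")] -/
theorem planarAdj_rotReflect (s t : ℤ) (z w : ℤ × ℤ) :
    planarAdj (rotReflect s t z) (rotReflect s t w) ↔ planarAdj z w := by
  obtain ⟨x, y⟩ := z
  obtain ⟨x', y'⟩ := w
  simp only [rotReflect_apply, planarAdj, Prod.mk_add_mk, Prod.mk.injEq, add_zero]
  omega

/-- The image of a rectangle under `rotReflect (a+b) (c+d)` is the transposed rectangle.
[cite: NewmanTassionWu2017, §3.3 ("by symmetry")] -/
theorem image_rotReflect_boxR (a b c d : ℤ) :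
    rotReflect (a + b) (c + d) '' boxR a b c d = boxR c d a b := by
  ext z
  simp only [Set.mem_image, rotReflect_apply, mem_boxR_iff]
  constructor
  · rintro ⟨w, hw, rfl⟩
    dsimp only
    omega
  · intro hz
    refine ⟨(a + b - z.2, c + d - z.1), by dsimp only; omega, ?_⟩
    ext <;> simp

/-- **Bottom-to-right-high against top-to-right-low.** In `S = [a,b] × [c,d]`, every planar walk
in `S` from the bottom row to a cell of the right side at height `≥ t` meets every planar walk in `S`
from the top row to a cell of the right side at height `≤ t`.
[cite: NewmanTassionWu2017, §3.3 (proof of Proposition 3.9, (3.29): hypothesis of GL0, rotated)] -/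
theorem planarCrossing_bottom_top_rightSegs {a b c d t : ℤ} {A B C D : Set (ℤ × ℤ)}
    (hA : ∀ z ∈ A, z.2 = c) (hB : ∀ z ∈ B, z.1 = b ∧ t ≤ z.2) (hC : ∀ z ∈ C, z.2 = d)
    (hD : ∀ z ∈ D, z.1 = b ∧ z.2 ≤ t) : PlanarCrossing (boxR a b c d) A B C D := by
  refine PlanarCrossing.of_image (planarAdj_rotReflect (a + b) (c + d)) ?_
  rw [image_rotReflect_boxR]
  refine planarCrossing_sides_bottom (a := c) (b := d) (c := a) (d := b) (t := c + d - t) ?_ ?_ ?_ ?_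
  · rintro z ⟨w, hw, rfl⟩
    simp only [rotReflect_apply, hA w hw]; ring
  · rintro z ⟨w, hw, rfl⟩
    obtain ⟨h1, h2⟩ := hB w hw
    simp only [rotReflect_apply, h1]
    constructor <;> omega
  · rintro z ⟨w, hw, rfl⟩
    simp only [rotReflect_apply, hC w hw]; ring
  · rintro z ⟨w, hw, rfl⟩
    obtain ⟨h1, h2⟩ := hD w hw
    simp only [rotReflect_apply, h1]
    constructor <;> omega

/-- **The two-domain planar crossing for the segment-target geometry**: in
`S = [a,b]×[c,d] ⊆ R = [a,b]×[c,d']`, every planar walk in `S` from the bottom row to a right-side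
cell at height `≥ t` meets every planar walk in `R` from the row `y = d'` to a right-side cell at
height `≤ t`, provided `t < d` (the latter's final portion after its last visit to `{y ≥ d}` is a walk
in `S` from the top row of `S`). [cite: NewmanTassionWu2017, Proposition 3.9 (proof, (3.29))] -/
theorem cross₂_of_segExtTop {a b c d d' t : ℤ} (htd : t < d) (hdd' : d ≤ d') {A B C Dd : Set (ℤ × ℤ)}
    (hA : ∀ z ∈ A, z.2 = c) (hB : ∀ z ∈ B, z.1 = b ∧ t ≤ z.2) (hC : ∀ z ∈ C, z.2 = d')
    (hD : ∀ z ∈ Dd, z.1 = b ∧ z.2 ≤ t) :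
    ∀ (l₁ l₂ : List (ℤ × ℤ)) (h₁ : l₁ ≠ []) (h₂ : l₂ ≠ []), IsPlanarWalk l₁ → IsPlanarWalk l₂ →
      (∀ z ∈ l₁, z ∈ boxR a b c d) → (∀ z ∈ l₂, z ∈ boxR a b c d') → l₁.head h₁ ∈ A → l₁.getLast h₁ ∈ B →
      l₂.head h₂ ∈ C → l₂.getLast h₂ ∈ Dd → ∃ z ∈ l₁, z ∈ l₂ := by
  intro l₁ l₂ h₁ h₂ hw₁ hw₂ hS₁ hS₂ hhA hlB hhC hlD
  have hrev : ∃ x ∈ l₂.reverse, d ≤ x.2 :=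
    ⟨l₂.head h₂, by simp [List.head_mem h₂], by rw [hC _ hhC]; exact hdd'⟩
  obtain ⟨m₁, x, m₂, hmeq, hxb, hm₁⟩ := exists_first_split (p := fun z : ℤ × ℤ => d ≤ z.2) l₂.reverse hrev
  have hl₂eq : l₂ = m₂.reverse ++ x :: m₁.reverse := by
    have := congrArg List.reverse hmeq
    simpa using this
  set suf := x :: m₁.reverse with hsuf
  have hsufsub : ∀ z ∈ suf, z ∈ l₂ := by
    intro z hz; rw [hl₂eq]; exact List.mem_append_right _ hz
  have hwsuf : IsPlanarWalk suf := by
    have hw : IsPlanarWalk (m₂.reverse ++ suf) := by rw [hsuf, ← hl₂eq]; exact hw₂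
    exact (List.isChain_append.1 hw).2.1
  have hlast : suf.getLast (by simp [hsuf]) = l₂.getLast h₂ := by
    rw [List.getLast_congr _ (by simp [hsuf]) hl₂eq]
    simp [hsuf]
  have hm₁ne : m₁ ≠ [] := by
    intro hm
    have : suf.getLast (by simp [hsuf]) = x := by simp [hsuf, hm]
    rw [hlast] at this
    have h1 := (hD _ hlD).2
    rw [this] at h1
    omega
  have hxeq : x.2 = d := by
    obtain ⟨y, ys, hys⟩ := List.exists_cons_of_ne_nil (show m₁.reverse ≠ [] by simpa using hm₁ne)
    have hy : ¬d ≤ y.2 := hm₁ y (by rw [← List.mem_reverse, hys]; simp)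
    have hstep : x = y ∨ planarAdj x y := by
      have : IsPlanarWalk (x :: y :: ys) := by rw [hsuf, hys] at hwsuf; exact hwsuf
      exact (List.isChain_cons_cons.1 this).1
    rcases hstep with rfl | h
    · exact absurd hxb hy
    · obtain ⟨x1, x2⟩ := x; obtain ⟨y1, y2⟩ := y
      simp only [planarAdj, Prod.mk_add_mk, Prod.mk.injEq, add_zero] at h
      simp only at hxb hy ⊢
      omega
  have hsufS : ∀ z ∈ suf, z ∈ boxR a b c d := by
    intro z hz
    have hzR := hS₂ z (hsufsub z hz)
    rw [mem_boxR_iff] at hzR ⊢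
    rw [hsuf, List.mem_cons] at hz
    rcases hz with rfl | hz
    · omega
    · have : ¬d ≤ z.2 := hm₁ z (by rw [← List.mem_reverse]; exact hz)
      omega
  have hne : suf ≠ [] := by simp [hsuf]
  have hhead' : (suf.head hne).2 = d := by simpa [hsuf] using hxeq
  have hlast' : suf.getLast hne ∈ Dd := by rw [hlast]; exact hlD
  obtain ⟨z, hz₁, hz₂⟩ := planarCrossing_bottom_top_rightSegs (A := A) (B := B) (C := {z | z.2 = d})
    (D := Dd) hA hB (fun z hz => hz) hD l₁ suf h₁ hne hw₁ hwsuf hS₁ hsufS hhA hlB hhead' hlast'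
  exact ⟨z, hz₁, hsufsub z hz₂⟩

/-! ## The `Γ`-free gluing lemma -/

/-- **GL in the high-probability regime for the segment-target geometry, `Γ`-free form** ((3.29)
rotated): for every `k ≥ 1`, `ρ ≥ 2`, `ε > 0`, `η > 0` there is `δ > 0` such that for every
`SegExtSetup` `W` with `y₂ + 2ρ + 6 ≤ d`, `A` on the bottom row, `C` on the row `y = d'`, `D'` on the
column `x = b` at heights `≤ t` with `t < y₁`, `dist*(A,C) > 4ρ+8`, `dist*(C,S) > 2ρ+3`, and every
`p ∈ [ε,1-ε]`: `P_p[A ⟷^S B] ≥ 1-δ` and `P_p[C ⟷^R D'] ≥ 1-δ` imply `P_p[C ⟷^R A] ≥ 1-η`.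
[cite: NewmanTassionWu2017, Proposition 3.9 (proof, (3.29)) with Theorem 3.6/3.7 (high-probability regime)] -/
theorem glue0_highProb_segExt (k ρ : ℕ) (hk : 1 ≤ k) (hρ : 2 ≤ ρ) {ε : ℝ} (hε : 0 < ε) {η : ℝ} (hη : 0 < η) :
    ∃ δ : ℝ, 0 < δ ∧ ∀ (W : SegExtSetup) (Dd : Set (ℤ × ℤ)) (t : ℤ), W.y₂ + 2 * ρ + 6 ≤ W.d →
      (∀ z ∈ W.A, z.2 = W.c) → (∀ z ∈ W.C, z.2 = W.d') → (∀ z ∈ Dd, z.1 = W.b ∧ z.2 ≤ t) → t < W.y₁ →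
      (∀ a' ∈ W.A, ∀ c' ∈ W.C, c' ∉ sqBox a' (4 * ρ + 8)) →
      (∀ c' ∈ W.C, ∀ s' ∈ W.S, c' ∉ sqBox s' (2 * ρ + 3)) →
      ∀ (p : unitInterval), ε ≤ (p : ℝ) → (p : ℝ) ≤ 1 - ε →
      1 - δ ≤ (bondPercolation (slabGraph 3 k) p).real (W.Q.evAB k) →
      1 - δ ≤ (bondPercolation (slabGraph 3 k) p).real (slabConn k W.R W.C Dd) →
      1 - η ≤ (bondPercolation (slabGraph 3 k) p).real (W.Q.evCA k) := by
  obtain ⟨δ, hδ, H⟩ := glue_highProb_segExt k ρ hk hρ hε hη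
  refine ⟨δ / 2, by linarith, fun W Dd t hBtop hA hC hD ht hsep hfarC p hpε hp1 hAB hCD => ?_⟩
  refine H W hBtop hsep hfarC p hpε hp1 ?_
  have hy₁ := W.hy₁; have hy := W.hy; have hy₂ := W.hy₂
  have hcross := cross₂_of_segExtTop (a := W.a) (b := W.b) (c := W.c) (d := W.d) (d' := W.d') (t := t)
    (A := W.Q.A) (B := W.Q.B) (C := W.Q.C) (Dd := Dd) (by omega) W.hdd' hA
    (fun z hz => ⟨(SegExtSetup.mem_B_iff.1 hz).1, by have := (SegExtSetup.mem_B_iff.1 hz).2.1; omega⟩) hC hD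
  have h := GlueData.real_evNear_ge_of_cross₂ (Q := W.Q) (k := k) (ρ := ρ) (Dd := Dd) hcross p
  have : (bondPercolation (slabGraph 3 k) p).real (slabConn k W.Q.R W.Q.C Dd) =
      (bondPercolation (slabGraph 3 k) p).real (slabConn k W.R W.C Dd) := rfl
  linarith

end NTW17

end Literature.Probability.Percolation

end
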